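import Summits.QuantumFields.YangMills.Theorems.AllWindowsColdBoxBoxHighLineGaussianNormalFormOnD
import Summits.QuantumFields.YangMills.Theorems.AllWindowsColdBoxBoxHighLineGaussCovMainReduction
import Summits.QuantumFields.YangMills.Theorems.AllWindowsColdBoxBoxHighLineMainTermWick

/-!
# T-S5.13f₀ — the `t = 0` end of the interpolation BY NAME: `|β²·Cov_{0,D}(c₀,c_T) − (3/4)·boxDirCircSqCov H T| ≤ 96·τ·β² + C/β`
# (ASSEMBLY-S5 §6 (e3) packaged: ✓13r restriction + ✓13m full-cost reduction + ✓11 main term; LINE-19 S5 ⟨stmt-QuantumFields-24004⟩)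

With `μ_D := (volume.restrict (smallField H s)).withDensity (ofReal ∘ gaussWeight β H)` (written out), `c_x := chartPlaqCost H x 1 2`, the (e3) line of
`Cruxes/BoxHighWindowsSU22/ASSEMBLY-S5.md` §6 is the three-step chain
`Tilt.tiltCov μ_D (tiltU β H) 0 c₀ c_T` —(✓13r, `|c| ≤ 4`: `≤ 6τ·4²`)→ `gaussCov β H c₀ c_T` —(✓13m: `≤ C/β³`)→ `gaussCov β H |ℓ₀|² |ℓ_T|²` —(✓11: `× β² = (3/4)·boxDirCircSqCov`)→ main term.
This file states it once, by name, for the assembler (free-hands seat ym-line-fcl-p3 g26):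

* `abs_gaussCov_sub_tiltCov_muD_zero_le` — `|gaussCov β H c_x c_y − Tilt.tiltCov μ_D (tiltU β H) 0 c_x c_y| ≤ 96·τ` whenever `E₀[1 − 1_{smallField s}] ≤ τ ≤ 1/2` (`β > 0`);
* ★★`abs_sq_mul_tiltCov_muD_zero_sub_main_le` — `∃ C, ∀ H ≥ 1, ∀ β ≥ 1, ∀ s τ, E₀[1 − 1_D] ≤ τ ≤ 1/2 → ∀ T,
  |β²·Tilt.tiltCov μ_D (tiltU β H) 0 c_{boxCentre} c_{boxCentre + T e₀} − (3/4)·boxDirCircSqCov H T| ≤ 96·τ·β² + C/β` (`C` = ✓13m's constant).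

Mathlib + tree (✓GaussianNormalFormOnD → ✓RestrictionCov, LEAD's ✓GaussCovMainReduction, ✓MainTermWick); no definitions.  HONEST LABEL: bookkeeping for the T-S5.13 assembly of the
XL stub S5 of a critic-PASSed DRAFT line; S5, U5, ⟨24004⟩ ⟨24335⟩ ⟨24336⟩ remain OPEN; route AllWindowsColdBox is DRAFT; no rung is proved; **the Yang–Mills mass gap is NOT
proved by this file; no summit is proved by a line.**  Seat ym-line-fcl-p3 g26 (cell ym-idea-1).
-/

set_option autoImplicit false

noncomputable section

open MeasureTheory Set
open Literature.Probability.LatticeModels (Site)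
open Summit.QuantumFields.YangMills.Theorems.WeakCouplingRates (boxCentre plaq12At boxDirCircSqCov)

namespace Summit.QuantumFields.YangMills.Theorems.AllWindowsColdBoxBoxHighLine

namespace GaussNormalForm

variable {H : ℕ} {β : ℝ}

/-- **(e3), restriction step in `μ_D` letters**: `|gaussCov β H c_x c_y − Tilt.tiltCov μ_D (tiltU β H) 0 c_x c_y| ≤ 96·τ` for the plaquette costs
`c_x = chartPlaqCost H x 1 2` (`|c| ≤ 4`), whenever `E₀[1 − 1_{smallField H s}] ≤ τ ≤ 1/2` (✓13r + ✓`muD_eq_restrict`). -/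
theorem abs_gaussCov_sub_tiltCov_muD_zero_le (hβ : 0 < β) (s : ℝ) {τ : ℝ} (hτ : gaussAvg β H (fun a => 1 - sfInd H s a) ≤ τ) (hτ2 : τ ≤ 1 / 2)
    (x y : Site 4) :
    |gaussCov β H (chartPlaqCost H x 1 2) (chartPlaqCost H y 1 2) -
        Tilt.tiltCov (((volume : Measure (LandauFree H → E3)).restrict (smallField H s)).withDensity fun a => ENNReal.ofReal (gaussWeight β H a))
          (tiltU β H) 0 (chartPlaqCost H x 1 2) (chartPlaqCost H y 1 2)| ≤ 96 * τ := by
  rw [muD_eq_restrict]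
  have h := GaussRestrict.abs_gaussCov_sub_tiltCov_restrict_le H hβ s hτ hτ2 (tiltU β H) (EdgeChartGaussian.measurable_chartPlaqCost H x 1 2)
    (EdgeChartGaussian.measurable_chartPlaqCost H y 1 2) (PlaqObsL2.abs_chartPlaqCost_le H x 1 2) (PlaqObsL2.abs_chartPlaqCost_le H y 1 2)
  calc _ ≤ 6 * τ * (4 : ℝ) ^ 2 := h
    _ = 96 * τ := by ring

/-- ★★ **T-S5.13f₀ — the `t = 0` end of the interpolation.**  There is `C` (✓13m's) such that for all `H ≥ 1`, `β ≥ 1`, `s`, `τ` with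
`E₀[1 − 1_{smallField H s}] ≤ τ ≤ 1/2` and all `T`:
`|β² · Tilt.tiltCov μ_D (tiltU β H) 0 c₀ c_T − (3/4)·boxDirCircSqCov H T| ≤ 96·τ·β² + C/β`,
`c₀ = chartPlaqCost H (boxCentre H) 1 2`, `c_T = chartPlaqCost H (boxCentre H + T·e₀) 1 2` (✓13r → ✓13m → ✓11 `mainTermWick`). -/
theorem abs_sq_mul_tiltCov_muD_zero_sub_main_le : ∃ C : ℝ, ∀ H : ℕ, 1 ≤ H → ∀ β : ℝ, 1 ≤ β → ∀ s τ : ℝ,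
    gaussAvg β H (fun a => 1 - sfInd H s a) ≤ τ → τ ≤ 1 / 2 → ∀ T : ℕ,
      |β ^ 2 * Tilt.tiltCov (((volume : Measure (LandauFree H → E3)).restrict (smallField H s)).withDensity fun a => ENNReal.ofReal (gaussWeight β H a))
            (tiltU β H) 0 (chartPlaqCost H (boxCentre H) 1 2) (chartPlaqCost H (boxCentre H + Pi.single 0 (T : ℤ)) 1 2) -
          3 / 4 * boxDirCircSqCov H T| ≤ 96 * τ * β ^ 2 + C / β := by
  obtain ⟨C, hC⟩ := EdgeChartGaussian.gaussCov_chartPlaqCost_sub_linCurvSq_le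
  refine ⟨C, fun H hH β hβ1 s τ hτ hτ2 T => ?_⟩
  have hβ : 0 < β := by linarith
  set x := boxCentre H
  set y := boxCentre H + Pi.single 0 (T : ℤ)
  set tc := Tilt.tiltCov (((volume : Measure (LandauFree H → E3)).restrict (smallField H s)).withDensity fun a => ENNReal.ofReal (gaussWeight β H a))
    (tiltU β H) 0 (chartPlaqCost H x 1 2) (chartPlaqCost H y 1 2)
  set gc := gaussCov β H (chartPlaqCost H x 1 2) (chartPlaqCost H y 1 2)
  set gl := gaussCov β H (linCurvSq H (plaq12At x)) (linCurvSq H (plaq12At y))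
  have h1 : |gc - tc| ≤ 96 * τ := abs_gaussCov_sub_tiltCov_muD_zero_le hβ s hτ hτ2 x y
  have h2 : |gc - gl| ≤ C / β ^ 3 := hC H hH β hβ1 x y
  have h3 : β ^ 2 * gl = 3 / 4 * boxDirCircSqCov H T := mainTermWick H hH β hβ T
  have e : β ^ 2 * tc - 3 / 4 * boxDirCircSqCov H T = β ^ 2 * (tc - gc) + β ^ 2 * (gc - gl) := by rw [← h3]; ring
  rw [e]
  have hβ2 : 0 ≤ β ^ 2 := sq_nonneg _
  calc |β ^ 2 * (tc - gc) + β ^ 2 * (gc - gl)| ≤ |β ^ 2 * (tc - gc)| + |β ^ 2 * (gc - gl)| := abs_add_le _ _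
    _ = β ^ 2 * |tc - gc| + β ^ 2 * |gc - gl| := by rw [abs_mul, abs_mul, abs_of_nonneg hβ2]
    _ ≤ β ^ 2 * (96 * τ) + β ^ 2 * (C / β ^ 3) := by
        rw [abs_sub_comm] at h1
        exact add_le_add (mul_le_mul_of_nonneg_left h1 hβ2) (mul_le_mul_of_nonneg_left h2 hβ2)
    _ = 96 * τ * β ^ 2 + C / β := by
        field_simp

end GaussNormalForm

end Summit.QuantumFields.YangMills.Theorems.AllWindowsColdBoxBoxHighLine

end
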